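import Summits.CriticalPhenomena.CardyFormulaZ2.Theses.CardyRotToConf
import Summits.CriticalPhenomena.CardyFormulaZ2.Theorems.CardyRotToConfR2SymmetryUpgrade.Negative.SurgSubarcImages
import Literature.Probability.RandomPlanarGeometry.SLENoTracedCircle
import HarnessLib

/-!
# SLE₆ laws trace no straight segment and no circle arc (line `germ-label-transport`, crux `stmt-CriticalPhenomena-0698`)

The law-level, all-representatives form of `IsSLECurve.ae_forall_not_collinear_image`
(`SLENoTracedLine.lean`, from arc confinement of the SLE_κ trace, `4 < κ < 8`): for a chordal
SLE_κ law `μ` of a Dobrushin domain, `μ`-a.e. curve class has NO representative mapping a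
non-trivial parameter interval non-constantly into a straight line. At `κ = 6` this is the
hypothesis `SLESixNoTracedSegment` of the disprover's one-shot-surgery skeleton (Disproof §13) and
the regularity of the SLE₆ family needed by `stub_secondFamily` (with the circle analogue
`ae_noTracedCircle_of_isSLELaw` from `IsSLECurve.ae_forall_not_subset_sphere`, `SLENoTracedCircle.lean`).
One representative suffices by the invariance of sub-arc images under reparametrisation
(`Negative.SurgSubarcImages.image_Icc_eq_of_mk_eq_mk`); the event is Borel
(`CurveClass.measurableSet_setOf_tracesLine`), so the statement passes to the law.
-/

noncomputable section

open Set MeasureTheory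
open scoped unitInterval NNReal

namespace Summit.CriticalPhenomena.CardyFormulaZ2.Theorems.CardyRotToConfR2SymmetryUpgrade

open Literature.Probability.RandomPlanarGeometry
open Summit.CriticalPhenomena.CardyFormulaZ2.Theorems.CardyRotToConfR2SymmetryUpgrade.Negative

/-- **Chordal SLE_κ laws trace no straight segment, `4 < κ < 8`.** For an SLE_κ law `μ` in a
Dobrushin domain, `μ`-a.e. class `γ` satisfies: for every representative `c` and all `s < t`, if
`c '' [s, t]` is collinear then it is a single point. [cite: RohdeSchramm2005, §7] -/
theorem ae_noTracedLine_of_isSLELaw {κ : ℝ≥0} (hκ4 : 4 < κ) (hκ8 : κ < 8) {D : DobrushinDomain}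
    {μ : Measure (CurveClass ℂ)} (hμ : IsSLELaw κ D μ) :
    ∀ᵐ γ ∂μ, ∀ c : Curve ℂ, CurveClass.mk c = γ → ∀ s t : I, s < t →
      Collinear ℝ ((c : I → ℂ) '' Icc s t) → ((c : I → ℂ) '' Icc s t).Subsingleton := by
  obtain ⟨Γ, hΓ, rfl⟩ := hμ
  set N : Set (CurveClass ℂ) := {γ | ∃ c : Curve ℂ, CurveClass.mk c = γ ∧ ∃ s t : I, s < t ∧
      Collinear ℝ ((c : I → ℂ) '' Icc s t) ∧ ¬ ((c : I → ℂ) '' Icc s t).Subsingleton} with hN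
  have hNm : MeasurableSet N := CurveClass.measurableSet_setOf_tracesLine
  have hzero : Literature.Probability.Process.preWienerMeasure (Γ ⁻¹' N) = 0 := by
    rw [measure_eq_zero_iff_ae_notMem]
    filter_upwards [hΓ.ae_forall_not_collinear_image hκ4 hκ8] with ω hω hmem
    obtain ⟨c₀, hc₀, hno⟩ := hω
    obtain ⟨c, hc, s, t, hst, hcol, hns⟩ := hmem
    obtain ⟨s', t', hle, heq⟩ := image_Icc_eq_of_mk_eq_mk (hc.trans hc₀) s t hst.le
    rw [heq] at hcol hns
    rcases hle.lt_or_eq with hlt | rfl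
    · exact hno s' t' hlt hcol
    · exact hns (by rw [Icc_self, image_singleton]; exact subsingleton_singleton)
  have hμN : (Literature.Probability.Process.preWienerMeasure.map Γ) N = 0 := by
    rw [Measure.map_apply_of_aemeasurable hΓ.1 hNm, hzero]
  filter_upwards [measure_eq_zero_iff_ae_notMem.1 hμN] with γ hγ c hc s t hst hcol
  by_contra hns
  exact hγ ⟨c, hc, s, t, hst, hcol, hns⟩

/-- **The SLE₆ case**, in the shape of the disprover's `SLESixNoTracedSegment` (Disproof §13).
[cite: RohdeSchramm2005, §7] -/
theorem sleSix_noTracedSegment :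
    ∀ (D : DobrushinDomain) (μ : Measure (CurveClass ℂ)), IsSLELaw 6 D μ →
      ∀ᵐ γ ∂μ, ∀ c : Curve ℂ, CurveClass.mk c = γ →
        ∀ s t : I, s < t → Collinear ℝ ((c : I → ℂ) '' Icc s t) →
          ((c : I → ℂ) '' Icc s t).Subsingleton :=
  fun _ _ hμ ↦ ae_noTracedLine_of_isSLELaw (by norm_num) (by norm_num) hμ

/-- **Chordal SLE_κ laws trace no circle arc, `4 < κ < 8`.** For an SLE_κ law `μ` in a Dobrushin
domain, `μ`-a.e. class `γ` satisfies: for every representative `c`, all `s < t`, every centre `m`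
and radius `R > 0`, if `c '' [s, t] ⊆ sphere m R` then it is a single point. [cite: RohdeSchramm2005, §7] -/
theorem ae_noTracedCircle_of_isSLELaw {κ : ℝ≥0} (hκ4 : 4 < κ) (hκ8 : κ < 8) {D : DobrushinDomain}
    {μ : Measure (CurveClass ℂ)} (hμ : IsSLELaw κ D μ) :
    ∀ᵐ γ ∂μ, ∀ c : Curve ℂ, CurveClass.mk c = γ → ∀ s t : I, s < t → ∀ (m : ℂ) (R : ℝ), 0 < R →
      (c : I → ℂ) '' Icc s t ⊆ Metric.sphere m R → ((c : I → ℂ) '' Icc s t).Subsingleton := by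
  obtain ⟨Γ, hΓ, rfl⟩ := hμ
  set N : Set (CurveClass ℂ) := {γ | ∃ c : Curve ℂ, CurveClass.mk c = γ ∧ ∃ s t : I, s < t ∧
      ∃ m : ℂ, ∃ R : ℝ, 0 < R ∧ (c : I → ℂ) '' Icc s t ⊆ Metric.sphere m R ∧
        ¬ ((c : I → ℂ) '' Icc s t).Subsingleton} with hN
  have hNm : MeasurableSet N := CurveClass.measurableSet_setOf_tracesCircle
  have hzero : Literature.Probability.Process.preWienerMeasure (Γ ⁻¹' N) = 0 := by
    rw [measure_eq_zero_iff_ae_notMem]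
    filter_upwards [hΓ.ae_forall_not_subset_sphere hκ4 hκ8] with ω hω hmem
    obtain ⟨c₀, hc₀, hno⟩ := hω
    obtain ⟨c, hc, s, t, hst, m, R, hR, hsub, hns⟩ := hmem
    obtain ⟨s', t', hle, heq⟩ := image_Icc_eq_of_mk_eq_mk (hc.trans hc₀) s t hst.le
    rw [heq] at hsub hns
    rcases hle.lt_or_eq with hlt | rfl
    · exact hno s' t' hlt m R hR hsub
    · exact hns (by rw [Icc_self, image_singleton]; exact subsingleton_singleton)
  have hμN : (Literature.Probability.Process.preWienerMeasure.map Γ) N = 0 := by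
    rw [Measure.map_apply_of_aemeasurable hΓ.1 hNm, hzero]
  filter_upwards [measure_eq_zero_iff_ae_notMem.1 hμN] with γ hγ c hc s t hst m R hR hsub
  by_contra hns
  exact hγ ⟨c, hc, s, t, hst, m, R, hR, hsub, hns⟩

/-- **The SLE₆ case** (no traced circle arc). [cite: RohdeSchramm2005, §7] -/
theorem sleSix_noTracedCircle :
    ∀ (D : DobrushinDomain) (μ : Measure (CurveClass ℂ)), IsSLELaw 6 D μ →
      ∀ᵐ γ ∂μ, ∀ c : Curve ℂ, CurveClass.mk c = γ → ∀ s t : I, s < t →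
        ∀ (m : ℂ) (R : ℝ), 0 < R → (c : I → ℂ) '' Icc s t ⊆ Metric.sphere m R →
          ((c : I → ℂ) '' Icc s t).Subsingleton :=
  fun _ _ hμ ↦ ae_noTracedCircle_of_isSLELaw (by norm_num) (by norm_num) hμ

/-- **Registered stub `stub_sleSixNoTracedSegment`** (= `sleSix_noTracedSegment`; the Disproof's
§13 hypothesis `SLESixNoTracedSegment` in tracing form). [cite: RohdeSchramm2005, Thm 6.4] -/
theorem stub_sleSixNoTracedSegment : ∀ (D : DobrushinDomain) (μ : MeasureTheory.Measure (CurveClass ℂ)), IsSLELaw 6 D μ → ∀ᵐ γ ∂μ, ∀ c : Curve ℂ, CurveClass.mk c = γ → ∀ s t : unitInterval, s < t → Collinear ℝ (c '' Set.Icc s t) → (c '' Set.Icc s t).Subsingleton :=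
  sleSix_noTracedSegment

/-- **Registered stub `stub_sleSixNoTracedCircle`** (= `sleSix_noTracedCircle`; tracing form of
"no circle sub-arc", the regularity behind `NoRoundTip`). [cite: RohdeSchramm2005, Thm 6.4] -/
theorem stub_sleSixNoTracedCircle : ∀ (D : DobrushinDomain) (μ : MeasureTheory.Measure (CurveClass ℂ)), IsSLELaw 6 D μ → ∀ᵐ γ ∂μ, ∀ c : Curve ℂ, CurveClass.mk c = γ → ∀ s t : unitInterval, s < t → ∀ (m : ℂ) (R : ℝ), 0 < R → c '' Set.Icc s t ⊆ Metric.sphere m R → (c '' Set.Icc s t).Subsingleton :=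
  sleSix_noTracedCircle

end Summit.CriticalPhenomena.CardyFormulaZ2.Theorems.CardyRotToConfR2SymmetryUpgrade

end
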